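import Literature.Barriers.ValiantsHypothesis.BIJL18MatrixCompletion
import Mathlib.LinearAlgebra.Dimension.Constructions
import HarnessLib

/-!
# Bläser–Ikenmeyer–Jindal–Lysikov 2018, §3 — discharge of Lemma 11 (completion rank of the
Max-2-SAT tensor)

Sibling proof file of `BIJL18MatrixCompletion.lean` (val-lit t23). Proves the named fact
`BIJL2018_lemma11 K`: for the §3 tensor `T_φ = (A₀, A₁, …, A_t)` of a 2-CNF `φ` with `s` clauses,
`CR(T_φ) ≤ 2s − b` iff some Boolean assignment satisfies at least `b` clauses
[BlaserIkenmeyerJindalLysikov2018, Lemma 11]. The printed proof ("By using the above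
observations, the following lemma follows immediately", ECCC p.9): the pencil `A₀ + Σ λ_k A_k`
is block diagonal with the clause gadgets `[[1-ℓ₁, 1],[0, 1-ℓ₂]]` at the literal values induced
by `λ`, so its rank is `Σᵢ rk(gadgetᵢ) = 2s − #{clauses with a literal equal to 1}` (Obs. 10),
and a field point `λ` satisfies at most as many clauses in this sense as the Boolean assignment
`x_k := [λ_k = 1]`, with equality for `0/1` points. Ingredients proved here: the rank of a block
diagonal matrix is the sum of the ranks of its blocks (`rank_blockDiagonal`; cf. the sigma-indexed
square-block variant `Literature.LinearAlgebra.Matrix.rank_blockDiagonal'` (Horn–Johnson 0.9.2) in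
`JordanCanonicalFormUniqueness.lean` — the uniform-block `Matrix.blockDiagonal` form is proved here
directly to keep the import closure small), the block structure of the pencil (`pencilEval_bijl_eq`).
This file is theorem-only (no new definitions; the `0/1` point of an assignment `σ` is written
`fun k => if σ k then 1 else 0`, as `Literature.Computability.AlgebraicComplexity.boolPoint`).
HONEST FRAMING: typed literature; `VP ≠ VNP` is NOT proved.
-/

noncomputable section

namespace Literature.Barriers.ValiantsHypothesis

open Literature.Computability.AlgebraicComplexity Literature.Computability.Complexity MvPolynomial

universe u

/-! ### Rank of a block diagonal matrix -/

section BlockDiagonal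

variable {K : Type u} [Field K] {o m n : Type*} [Fintype o] [Fintype m] [Fintype n] [DecidableEq o]

omit [Fintype m] in
/-- Block diagonal matrices act blockwise. [folklore] -/
private theorem blockDiagonal_mulVec_apply (M : o → Matrix m n K) (v : n × o → K) (i : m) (k : o) :
    (Matrix.blockDiagonal M).mulVec v (i, k) = (M k).mulVec (fun j => v (j, k)) i := by
  simp only [Matrix.mulVec, dotProduct, Matrix.blockDiagonal_apply]
  rw [Fintype.sum_prod_type]
  simp only [ite_mul, zero_mul, Finset.sum_ite_eq, Finset.mem_univ, if_true]

omit [Fintype m] in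
/-- **The rank of a block diagonal matrix is the sum of the ranks of its blocks** (over a field).
[cite: BlaserIkenmeyerJindalLysikov2018, Lemma 11 (proof: block diagonal clause gadgets)] -/
theorem rank_blockDiagonal (M : o → Matrix m n K) :
    (Matrix.blockDiagonal M).rank = ∑ k, (M k).rank := by
  classical
  -- a linear equivalence between the range of the block diagonal map and the product of ranges
  let Φ : LinearMap.range (Matrix.blockDiagonal M).mulVecLin ≃ₗ[K]
      ∀ k, LinearMap.range (M k).mulVecLin :=
    { toFun := fun x => fun k => ⟨fun i => x.1 (i, k), by
        obtain ⟨v, hv⟩ := x.2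
        refine ⟨fun j => v (j, k), ?_⟩
        funext i
        rw [← hv]
        exact (blockDiagonal_mulVec_apply M v i k).symm⟩
      map_add' := fun _ _ => rfl
      map_smul' := fun _ _ => rfl
      invFun := fun y => ⟨fun p => (y p.2).1 p.1, by
        choose v hv using fun k => (y k).2
        refine ⟨fun p => v p.2 p.1, ?_⟩
        funext p
        rw [Matrix.mulVecLin_apply, blockDiagonal_mulVec_apply]
        have := congrFun (hv p.2) p.1
        simpa [Matrix.mulVecLin_apply] using this⟩
      left_inv := fun _ => rfl
      right_inv := fun _ => rfl }
  rw [Matrix.rank, Φ.finrank_eq, Module.finrank_pi_fintype]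
  rfl

end BlockDiagonal

/-! ### The block structure of the §3 pencil -/

section Gadget

variable (K : Type u) [Field K] {t : ℕ}

/-- The value of the affine form `1 - ℓ` at `c`: constant plus the `x_k`-coefficients times `c_k`.
[cite: BlaserIkenmeyerJindalLysikov2018, §3] locator: ECCC p.9 -/
theorem litConst_add_sum_litCoeff (l : Literal (Fin t)) (c : Fin t → K) :
    litConst K l + ∑ k, c k * litCoeff K l k = 1 - litVal K l c := by
  unfold litConst litCoeff litVal
  have e : ∀ k, c k * (if l.1 = k then (if l.2 = true then (-1 : K) else 1) else 0) =
      if k = l.1 then c l.1 * (if l.2 = true then (-1 : K) else 1) else 0 := by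
    intro k
    by_cases hk : k = l.1
    · subst hk; simp
    · rw [if_neg (fun h => hk h.symm), if_neg hk, mul_zero]
  simp only [e, Finset.sum_ite_eq', Finset.mem_univ, if_true]
  cases l.2
  · simp
  · simp; ring

/-- **The pencil of the §3 tensor is block diagonal with the clause gadgets on the diagonal**:
`A₀ + Σ_k c_k A_k = blockdiag(gadget₁(c), …, gadget_s(c))` (rows/columns `(i, a)`).
[cite: BlaserIkenmeyerJindalLysikov2018, Lemma 11 (proof) and Obs. 12] locator: ECCC p.9 -/
theorem pencilEval_bijl_eq (φ : List (Literal (Fin t) × Literal (Fin t))) (c : Fin t → K) :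
    pencilEval (bijlA₀ K φ) (bijlSlices K φ) c =
      Matrix.reindex (Equiv.prodComm _ _) (Equiv.prodComm _ _)
        (Matrix.blockDiagonal fun i =>
          clauseGadget K (litVal K (clauseLit φ i 0) c) (litVal K (clauseLit φ i 1) c)) := by
  ext ⟨i, a⟩ ⟨i', a'⟩
  simp only [pencilEval, Matrix.add_apply, Matrix.sum_apply, Matrix.smul_apply, smul_eq_mul,
    Matrix.reindex_apply, Matrix.submatrix_apply, Equiv.prodComm_symm, Equiv.prodComm_apply,
    Prod.swap_prod_mk, Matrix.blockDiagonal_apply', bijlA₀, bijlSlices, Prod.mk.injEq]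
  by_cases hi : i = i'
  · subst hi
    by_cases ha : a = a'
    · subst ha
      simp only [and_self, if_true]
      rw [litConst_add_sum_litCoeff]
      fin_cases a <;> simp [clauseGadget]
    · simp only [true_and, if_true, if_neg ha, mul_zero, Finset.sum_const_zero, add_zero]
      fin_cases a <;> fin_cases a' <;> simp_all [clauseGadget]
  · simp [hi]

/-- **Rank of the pencil**: `rk(A₀ + Σ c_k A_k) + #{clauses satisfied at c} = 2s`, where clause `i`
is *satisfied at `c`* when one of its literal forms takes the value `1` at `c` ("`ε`-satisfied" at
`ε = 0`; Obs. 10 blockwise and `rank_blockDiagonal`). [cite: BlaserIkenmeyerJindalLysikov2018, Lemma 11 (proof)] locator: ECCC p.9 -/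
theorem rank_pencilEval_bijl (φ : List (Literal (Fin t) × Literal (Fin t))) (c : Fin t → K) :
    (pencilEval (bijlA₀ K φ) (bijlSlices K φ) c).rank +
        Nat.card {i : Fin φ.length // litVal K (clauseLit φ i 0) c = 1 ∨ litVal K (clauseLit φ i 1) c = 1} =
      2 * φ.length := by
  classical
  rw [pencilEval_bijl_eq, Matrix.rank_reindex, rank_blockDiagonal, Nat.card_eq_fintype_card,
    Fintype.card_subtype]
  have hblock : ∀ i : Fin φ.length,
      (clauseGadget K (litVal K (clauseLit φ i 0) c) (litVal K (clauseLit φ i 1) c)).rank =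
        if litVal K (clauseLit φ i 0) c = 1 ∨ litVal K (clauseLit φ i 1) c = 1 then 1 else 2 := by
    intro i
    by_cases h : litVal K (clauseLit φ i 0) c = 1 ∨ litVal K (clauseLit φ i 1) c = 1
    · rw [if_pos h]; exact ((BIJL2018_obs10 K _ _).1).2 h
    · rw [if_neg h]; exact (BIJL2018_obs10 K _ _).2 h
  simp only [hblock]
  rw [Finset.sum_ite, Finset.sum_const, Finset.sum_const, smul_eq_mul, smul_eq_mul, mul_one]
  have hcard := Finset.card_filter_add_card_filter_not
    (s := (Finset.univ : Finset (Fin φ.length)))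
    (p := fun i => litVal K (clauseLit φ i 0) c = 1 ∨ litVal K (clauseLit φ i 1) c = 1)
  simp only [Finset.card_univ, Fintype.card_fin] at hcard
  omega

open Classical in
/-- `#{clauses satisfied at c}` as an indicator sum. [cite: BlaserIkenmeyerJindalLysikov2018, Lemma 11 (proof)] -/
theorem natCard_satAt_eq_sum (φ : List (Literal (Fin t) × Literal (Fin t))) (c : Fin t → K) :
    Nat.card {i : Fin φ.length // litVal K (clauseLit φ i 0) c = 1 ∨ litVal K (clauseLit φ i 1) c = 1} =
      ∑ i : Fin φ.length, if litVal K (clauseLit φ i 0) c = 1 ∨ litVal K (clauseLit φ i 1) c = 1 then 1 else 0 := by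
  classical
  rw [Nat.card_eq_fintype_card, Fintype.card_subtype, Finset.card_filter]

/-- At the `0/1` point `k ↦ [σ k]` of a Boolean assignment `σ`, a clause is satisfied at the point
iff `σ` satisfies it. [cite: BlaserIkenmeyerJindalLysikov2018, Lemma 11 (proof)] locator: ECCC p.9 -/
theorem satAt_boolPoint_iff (φ : List (Literal (Fin t) × Literal (Fin t))) (σ : Fin t → Bool)
    (i : Fin φ.length) :
    (litVal K (clauseLit φ i 0) (fun k => if σ k then (1 : K) else 0) = 1 ∨
        litVal K (clauseLit φ i 1) (fun k => if σ k then (1 : K) else 0) = 1) ↔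
      ((φ.get i).1.eval σ || (φ.get i).2.eval σ) = true := by
  have key : ∀ l : Literal (Fin t), litVal K l (fun k => if σ k then (1 : K) else 0) = 1 ↔ l.eval σ = true := by
    intro l
    unfold litVal Literal.eval
    rcases l with ⟨k, b⟩
    cases b <;> cases hk : σ k <;> simp [hk]
  simp only [clauseLit, key, Bool.or_eq_true]
  simp

/-- At any point `c`, a clause satisfied at `c` is satisfied by the Boolean assignment
`x_k := [c_k = 1]` ("By substituting `ε = 0` … we get an assignment", here at `ε = 0` already).
[cite: BlaserIkenmeyerJindalLysikov2018, Lemma 11 (proof), Lemma 14 (proof)] locator: ECCC pp.9–10 -/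
theorem eval_of_satAt (φ : List (Literal (Fin t) × Literal (Fin t))) (c : Fin t → K)
    (σ : Fin t → Bool) (hσ : ∀ k, σ k = true ↔ c k = 1) (i : Fin φ.length)
    (h : litVal K (clauseLit φ i 0) c = 1 ∨ litVal K (clauseLit φ i 1) c = 1) :
    ((φ.get i).1.eval σ || (φ.get i).2.eval σ) = true := by
  have key : ∀ l : Literal (Fin t), litVal K l c = 1 → l.eval σ = true := by
    rintro ⟨k, b⟩ hl
    unfold litVal at hl
    unfold Literal.eval
    cases b
    · simp only [Bool.false_eq_true, if_false] at hl
      have hk : c k ≠ 1 := by intro h1; rw [h1] at hl; norm_num at hl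
      have hσk : σ k = false := by
        cases h2 : σ k
        · rfl
        · exact absurd ((hσ k).1 h2) hk
      simp only [hσk]; rfl
    · simp only [if_true] at hl
      have hσk : σ k = true := (hσ k).2 hl
      simp [hσk]
  simp only [clauseLit] at h
  simp only [Bool.or_eq_true]
  rcases h with h | h
  · left; simpa using key _ h
  · right; simpa using key _ h

/-- Counting over list positions: `Σᵢ [P (l.get i)] = l.countP P`. [folklore] -/
private theorem sum_ite_get_eq_countP {α : Type*} (l : List α) (P : α → Bool) :
    (∑ i : Fin l.length, if P (l.get i) = true then 1 else 0) = l.countP P := by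
  induction l with
  | nil => simp
  | cons a l ih =>
    rw [List.countP_cons, ← ih]
    show (∑ i : Fin (l.length + 1), if P ((a :: l).get i) = true then 1 else 0) = _
    rw [Fin.sum_univ_succ, add_comm]
    congr 1

/-- `numSat₂ φ σ` as an indicator sum over clause positions. [cite: BlaserIkenmeyerJindalLysikov2018, §3] -/
theorem numSat₂_eq_sum (φ : List (Literal (Fin t) × Literal (Fin t))) (σ : Fin t → Bool) :
    numSat₂ φ σ = ∑ i : Fin φ.length,
      if ((φ.get i).1.eval σ || (φ.get i).2.eval σ) = true then 1 else 0 := by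
  rw [numSat₂, ← sum_ite_get_eq_countP]

/-- At a `0/1` point the two counts agree. [cite: BlaserIkenmeyerJindalLysikov2018, Lemma 11 (proof)] -/
theorem natCard_satAt_boolPoint (φ : List (Literal (Fin t) × Literal (Fin t))) (σ : Fin t → Bool) :
    Nat.card {i : Fin φ.length //
        litVal K (clauseLit φ i 0) (fun k => if σ k then (1 : K) else 0) = 1 ∨
        litVal K (clauseLit φ i 1) (fun k => if σ k then (1 : K) else 0) = 1} = numSat₂ φ σ := by
  classical
  rw [natCard_satAt_eq_sum, numSat₂_eq_sum]
  refine Finset.sum_congr rfl fun i _ => ?_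
  by_cases h : (litVal K (clauseLit φ i 0) (fun k => if σ k then (1 : K) else 0) = 1 ∨
        litVal K (clauseLit φ i 1) (fun k => if σ k then (1 : K) else 0) = 1)
  · rw [if_pos h, if_pos ((satAt_boolPoint_iff K φ σ i).1 h)]
  · rw [if_neg h, if_neg (fun h' => h ((satAt_boolPoint_iff K φ σ i).2 h'))]

/-- At any point, the count is at most the count of the induced Boolean assignment.
[cite: BlaserIkenmeyerJindalLysikov2018, Lemma 11 (proof)] -/
theorem natCard_satAt_le_numSat₂ (φ : List (Literal (Fin t) × Literal (Fin t))) (c : Fin t → K)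
    (σ : Fin t → Bool) (hσ : ∀ k, σ k = true ↔ c k = 1) :
    Nat.card {i : Fin φ.length // litVal K (clauseLit φ i 0) c = 1 ∨ litVal K (clauseLit φ i 1) c = 1} ≤ numSat₂ φ σ := by
  classical
  rw [natCard_satAt_eq_sum, numSat₂_eq_sum]
  refine Finset.sum_le_sum fun i _ => ?_
  by_cases h : litVal K (clauseLit φ i 0) c = 1 ∨ litVal K (clauseLit φ i 1) c = 1
  · rw [if_pos h, if_pos (eval_of_satAt K φ c σ hσ i h)]
  · rw [if_neg h]; exact Nat.zero_le _

/-- **BIJL Lemma 11 holds** (discharge of `BIJL2018_lemma11`).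
[cite: BlaserIkenmeyerJindalLysikov2018, Lemma 11] locator: ECCC p.9 -/
theorem BIJL2018_lemma11_holds : BIJL2018_lemma11 K := by
  classical
  intro t φ b
  constructor
  · intro hcr
    obtain ⟨c, hc⟩ := exists_rank_pencilEval_eq_completionRank (bijlA₀ K φ) (bijlSlices K φ)
    have hrk := rank_pencilEval_bijl K φ c
    refine ⟨fun k => decide (c k = 1), ?_⟩
    have hmono := natCard_satAt_le_numSat₂ K φ c (fun k => decide (c k = 1))
      (fun k => decide_eq_true_iff)
    rw [hc] at hrk
    omega
  · rintro ⟨σ, hσ⟩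
    have hle := completionRank_le (bijlA₀ K φ) (bijlSlices K φ) (fun k => if σ k then (1 : K) else 0)
    have hrk := rank_pencilEval_bijl K φ (fun k => if σ k then (1 : K) else 0)
    have hcount := natCard_satAt_boolPoint K φ σ
    omega

end Gadget

end Literature.Barriers.ValiantsHypothesis

end
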